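import Summits.QuantumFields.YangMills.Theorems.BalabanUVNodesN10GenAnalyticReadingOfTermwise226
import Mathlib.Analysis.Complex.Schwarz

/-!
# BalabanUVNodes ∕ N10 ([B13]) → N22 (NE9): [KP86] HOLOMORPHY OF (2.13) IN THE COMPLEX COUPLING ON AN OPEN SET, AND THE LIPSCHITZ STOREY FOR (2.13) ON THE
# ACTIVITY POLYDISC (module 109A — the one-step tools of module 109B `…N10GenLastCouplingOfTermSectors`)

Track A of `YM-PLAN.md` (cell `pub-ymgap`, D-0062), seat `pub-ymgap-dag-n10-c` g20, DAG edge **N10 → N22**.  THEOREMS ONLY (0 `def`, 0 `sorry`, standard axioms);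
`--supports stmt-QuantumFields-27364 --as helper`; COUNT-NEUTRAL.  One step, one domain, def-W1's torus geometry `tgeometry P.d (domCount P M (k+1))`:
* ★ `differentiableOn_and_norm_locE_of_couplingReading` — S25's [KP86] face `analytic_and_bounded_locE_param_of_geometry` at the parameter space `ℂ` (the complex
  COUPLING) and ANY open `O ⊆ ℂ`: read activities `h Z : ℂ → ℂ` holomorphic on `O` under one (2.38)-shape majorant `A·e^{−R₃₈ d(Z)}` + the two numerals ⟹
  `z ↦ locE … (fun Z ↦ h Z z) (cubes X)` holomorphic on `O`, bounded by `e·(2d+1)·4·2^d·K₀²·A·e^{−r₁ d(X)}` (module 101 §1 is the case `O = ball 0 R` in a Banach space).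
* ★ `norm_sub_le_of_diffOn_ball` — Schwarz (`Complex.dist_le_div_mul_dist_of_mapsTo_ball`): `f : ℂ → ℂ` holomorphic and bounded by `M_f` on `ball 0 R₁`, `1 < R₁` ⟹
  `‖f 1 − f 0‖ ≤ 2M_f∕R₁`.
* ★★ `norm_locE_sub_locE_le_of_deviation` — THE LIPSCHITZ STOREY FOR (2.13): activity families `H₀, H₁` of the polymers `Z ⊂ X`, both in the `A`-polydisc, with
  `‖H₁ Z − H₀ Z‖ ≤ q·A·e^{−R₃₈ d(Z)}` (`q ≥ 0` ARBITRARY) and the numerals at `2A` ⟹ `‖locE H₁ X − locE H₀ X‖ ≤ 2·(e(2d+1)4·2^d K₀²·(2A)·e^{−r₁ d(X)})·q` — the affine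
  pencil `H₀ + λ(H₁ − H₀)` stays in the `2A`-polydisc for `|λ| < 1∕q`, it is holomorphic in `λ` with the (2.41) bound, Schwarz at `λ = 1` (case `0 < q < 1`); the crude
  two-sided bound (case `q ≥ 1`); `locE_congr` (case `q = 0`).  [II] (2.41) p. 21 is the polydisc bound; the Lipschitz form is [folklore] complex analysis on it.
HONEST FRAMING (binding).  Kernel composition ([KP86] via S25 + Mathlib's Schwarz lemma); every activity letter and numeral is a DISPLAYED hypothesis; NO estimate of
Bałaban's is proved; N10 ∕ N22 NOT discharged (28∕28 · 6∕27 UNCHANGED); K-items untouched; one finite 𝕋⁴ programme at fixed ε — nothing continuum ∕ ℝ⁴ ∕ OS ∕ mass-gap ∕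
Clay.  References (TYPES only): [II] = Bałaban, CMP 116 (1988) (2.13) p. 14, (2.38) p. 20, (2.41) p. 21; [KP86] Kotecký–Preiss, CMP 103 (1986) Theorem p. 492.
-/

noncomputable section

open Set Metric
open scoped BigOperators

namespace YMDAG.N10

open Literature.MathematicalPhysics.QuantumFieldTheory.Balaban1983to89
open Literature.MathematicalPhysics.QuantumFieldTheory.Balaban1983to89.T4Continuum (T4Family)
open Literature.MathematicalPhysics.QuantumFieldTheory.Balaban1983to89.B12TreeDecay (K₀ kappa₀)
open Literature.MathematicalPhysics.QuantumFieldTheory.Balaban1983to89.B13Resummation (locE locE_congr)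
open Literature.MathematicalPhysics.QuantumFieldTheory.Balaban1983to89.TreeLengthTorusGeometry (tgeometry)
open Literature.MathematicalPhysics.QuantumFieldTheory.Balaban1983to89.B13Lemma3TorusTerms (terms weight weight_nonneg)
open Literature.MathematicalPhysics.QuantumFieldTheory.Balaban1983to89.B13Lemma3TorusSocket (Lemma3Numerics)
open Literature.MathematicalPhysics.QuantumFieldTheory.Balaban1983to89.Node00.Sect2 (domSys domCount CPair)
open Literature.MathematicalPhysics.QuantumFieldTheory.Balaban1983to89.Node00.W1
open Summit.QuantumFields.BalabanUV.T4Continuum.NE1p.DressedOutputAnalyticFaces (analytic_and_bounded_locE_param_of_geometry)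

/-! ## §1 One step, one domain: [KP86] in the complex coupling on an open set; the Lipschitz storey for (2.13) on the activity polydisc -/
section Step

variable {P : Params} {M k : ℕ}

open Classical in
/-- ★ **KOTECKÝ–PREISS HOLOMORPHY IN THE COMPLEX COUPLING ON AN OPEN SET + THE (2.41) ENVELOPE THERE.**  Read activities `h Z : ℂ → ℂ` of the polymers `Z ⊂ X`, complex
differentiable on an OPEN `O ⊆ ℂ` and dominated there by ONE (2.38)-shape majorant `A·e^{−R₃₈ d_{k+1}(Z)}`, with `r₁ + 2κ₀(4·2^d, 2d) + 2 ≤ R₃₈` and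
`A·e^{5r₁+1}·K₀(4·2^d, 2d)·(2d+1)·4·2^d ≤ 1` ⟹ `z ↦ locE … (fun Z ↦ h Z z) (cubes X)` is complex differentiable on `O` and bounded there by
`e·(2d+1)·4·2^d·K₀(4·2^d, 2d)²·A·e^{−r₁ d_{k+1}(X)}` — S25's face at `tgeometry P.d (domCount P M (k+1))`, parameter space `ℂ`. [folklore] -/
theorem differentiableOn_and_norm_locE_of_couplingReading (X : (domSys P M (k + 1)).Dom) {O : Set ℂ} (hO : IsOpen O)
    {h : (domSys P M (k + 1)).Dom → ℂ → ℂ} {A R₃₈ r₁ : ℝ} (hA : 0 ≤ A) (hr₁ : 0 ≤ r₁)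
    (hrate : r₁ + 2 * kappa₀ (4 * 2 ^ P.d) (2 * P.d) + 2 ≤ R₃₈)
    (hsmall : A * Real.exp (5 * r₁ + 1) * K₀ (4 * 2 ^ P.d) (2 * P.d) * (2 * (P.d : ℝ) + 1) * (4 * 2 ^ P.d) ≤ 1)
    (hhol : ∀ Z : (domSys P M (k + 1)).Dom, Subtype.val Z ⊆ Subtype.val X → DifferentiableOn ℂ (h Z) O)
    (h38 : ∀ Z : (domSys P M (k + 1)).Dom, Subtype.val Z ⊆ Subtype.val X → ∀ z ∈ O, ‖h Z z‖ ≤ A * Real.exp (-(R₃₈ * (domSys P M (k + 1)).dj Z))) :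
    DifferentiableOn ℂ (fun z => locE (tgeometry P.d (domCount P M (k + 1))).ι (tgeometry P.d (domCount P M (k + 1))).cubes (fun Z => h Z z)
        ((tgeometry P.d (domCount P M (k + 1))).cubes X)) O ∧
      ∀ z ∈ O, ‖locE (tgeometry P.d (domCount P M (k + 1))).ι (tgeometry P.d (domCount P M (k + 1))).cubes (fun Z => h Z z)
          ((tgeometry P.d (domCount P M (k + 1))).cubes X)‖ ≤
        Real.exp 1 * (2 * (P.d : ℝ) + 1) * (4 * 2 ^ P.d) * K₀ (4 * 2 ^ P.d) (2 * P.d) ^ 2 * A * Real.exp (-(r₁ * (domSys P M (k + 1)).dj X)) :=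
  analytic_and_bounded_locE_param_of_geometry (tgeometry P.d (domCount P M (k + 1)))
    (m := fun Z => A * Real.exp (-(R₃₈ * (domSys P M (k + 1)).dj Z))) (act := fun z Z => h Z z) (A := A) (R := R₃₈) (r₁ := r₁) X
    hO hA hr₁ hrate hsmall hhol (fun z hz Z hZ => h38 Z hZ z hz) (fun _ _ => le_rfl)

/-- ★ **SCHWARZ: A HOLOMORPHIC `f : ℂ → ℂ` BOUNDED BY `M_f` ON `ball 0 R₁`, `1 < R₁`, MOVES AT MOST `2M_f∕R₁` BETWEEN `0` AND `1`** — Mathlib's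
`Complex.dist_le_div_mul_dist_of_mapsTo_ball` into the closed ball `closedBall (f 0) (2M_f)`. [folklore] -/
theorem norm_sub_le_of_diffOn_ball {f : ℂ → ℂ} {R₁ Mf : ℝ} (hR₁ : 1 < R₁) (hf : DifferentiableOn ℂ f (ball 0 R₁))
    (hM : ∀ w ∈ ball (0 : ℂ) R₁, ‖f w‖ ≤ Mf) : ‖f 1 - f 0‖ ≤ 2 * Mf / R₁ := by
  have hR0 : 0 < R₁ := by linarith
  have h1 : (1 : ℂ) ∈ ball (0 : ℂ) R₁ := by simpa using hR₁
  have h0 : (0 : ℂ) ∈ ball (0 : ℂ) R₁ := mem_ball_self hR0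
  have hmaps : MapsTo f (ball (0 : ℂ) R₁) (closedBall (f 0) (2 * Mf)) := fun w hw => by
    rw [mem_closedBall, dist_eq_norm]
    calc ‖f w - f 0‖ ≤ ‖f w‖ + ‖f 0‖ := norm_sub_le _ _
      _ ≤ Mf + Mf := add_le_add (hM w hw) (hM 0 h0)
      _ = 2 * Mf := by ring
  have h := Complex.dist_le_div_mul_dist_of_mapsTo_ball hf hmaps h1
  rwa [dist_eq_norm, dist_eq_norm, sub_zero, norm_one, mul_one] at h

open Classical in
/-- ★★ **THE LIPSCHITZ STOREY FOR THE (2.13) MAP ON THE ACTIVITY POLYDISC.**  Two activity families `H₀, H₁` of the polymers `Z ⊂ X`, BOTH in the `A`-polydisc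
(`‖H_i Z‖ ≤ A·e^{−R₃₈ d_{k+1}(Z)}`), deviating by `‖H₁ Z − H₀ Z‖ ≤ q·A·e^{−R₃₈ d_{k+1}(Z)}` with `q ≥ 0` ARBITRARY, and the [KP86] numerals at `2A` ⟹
`‖locE H₁ X − locE H₀ X‖ ≤ 2·(e·(2d+1)·4·2^d·K₀²·(2A)·e^{−r₁ d_{k+1}(X)})·q`.  Proof: for `0 < q < 1` the affine pencil `λ ↦ H₀ + λ(H₁ − H₀)` stays in the
`2A`-polydisc on `|λ| < 1∕q`, §1 makes `λ ↦ locE (pencil λ) X` holomorphic and bounded there, Schwarz at `λ = 1`; for `q ≥ 1` the crude bound `‖locE H₁‖ + ‖locE H₀‖`;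
for `q = 0` the activities agree on `Z ⊂ X` (`locE_congr`). [folklore] -/
theorem norm_locE_sub_locE_le_of_deviation (X : (domSys P M (k + 1)).Dom) {H₀ H₁ : (domSys P M (k + 1)).Dom → ℂ} {A R₃₈ r₁ q : ℝ}
    (hA : 0 ≤ A) (hr₁ : 0 ≤ r₁) (hq : 0 ≤ q) (hrate : r₁ + 2 * kappa₀ (4 * 2 ^ P.d) (2 * P.d) + 2 ≤ R₃₈)
    (hsmall2 : 2 * A * Real.exp (5 * r₁ + 1) * K₀ (4 * 2 ^ P.d) (2 * P.d) * (2 * (P.d : ℝ) + 1) * (4 * 2 ^ P.d) ≤ 1)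
    (hH₀ : ∀ Z : (domSys P M (k + 1)).Dom, Subtype.val Z ⊆ Subtype.val X → ‖H₀ Z‖ ≤ A * Real.exp (-(R₃₈ * (domSys P M (k + 1)).dj Z)))
    (hH₁ : ∀ Z : (domSys P M (k + 1)).Dom, Subtype.val Z ⊆ Subtype.val X → ‖H₁ Z‖ ≤ A * Real.exp (-(R₃₈ * (domSys P M (k + 1)).dj Z)))
    (hdev : ∀ Z : (domSys P M (k + 1)).Dom, Subtype.val Z ⊆ Subtype.val X →
      ‖H₁ Z - H₀ Z‖ ≤ q * (A * Real.exp (-(R₃₈ * (domSys P M (k + 1)).dj Z)))) :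
    ‖locE (tgeometry P.d (domCount P M (k + 1))).ι (tgeometry P.d (domCount P M (k + 1))).cubes H₁ ((tgeometry P.d (domCount P M (k + 1))).cubes X) -
        locE (tgeometry P.d (domCount P M (k + 1))).ι (tgeometry P.d (domCount P M (k + 1))).cubes H₀ ((tgeometry P.d (domCount P M (k + 1))).cubes X)‖ ≤
      2 * (Real.exp 1 * (2 * (P.d : ℝ) + 1) * (4 * 2 ^ P.d) * K₀ (4 * 2 ^ P.d) (2 * P.d) ^ 2 * (2 * A) *
        Real.exp (-(r₁ * (domSys P M (k + 1)).dj X))) * q := by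
  obtain ⟨Mf, hMf⟩ : ∃ Mf : ℝ, Mf = Real.exp 1 * (2 * (P.d : ℝ) + 1) * (4 * 2 ^ P.d) * K₀ (4 * 2 ^ P.d) (2 * P.d) ^ 2 * (2 * A) *
      Real.exp (-(r₁ * (domSys P M (k + 1)).dj X)) := ⟨_, rfl⟩
  rw [← hMf]
  have hA2 : 0 ≤ 2 * A := by positivity
  have hK₀ : 0 ≤ K₀ (4 * 2 ^ P.d) (2 * P.d) := (B12TreeDecay.K₀_pos _ _).le
  have hMf0 : 0 ≤ Mf := by rw [hMf]; positivity
  -- the KP smallness at `A` follows from the one at `2A`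
  have hsmallA : A * Real.exp (5 * r₁ + 1) * K₀ (4 * 2 ^ P.d) (2 * P.d) * (2 * (P.d : ℝ) + 1) * (4 * 2 ^ P.d) ≤ 1 := by
    have : 0 ≤ A * Real.exp (5 * r₁ + 1) * K₀ (4 * 2 ^ P.d) (2 * P.d) * (2 * (P.d : ℝ) + 1) * (4 * 2 ^ P.d) := by positivity
    linarith
  -- any family in the `A`-polydisc has its (2.13) bounded by `Mf` (§1 at a coupling-constant reading, majorant `2A`)
  have hbd : ∀ H : (domSys P M (k + 1)).Dom → ℂ,
      (∀ Z : (domSys P M (k + 1)).Dom, Subtype.val Z ⊆ Subtype.val X → ‖H Z‖ ≤ A * Real.exp (-(R₃₈ * (domSys P M (k + 1)).dj Z))) →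
        ‖locE (tgeometry P.d (domCount P M (k + 1))).ι (tgeometry P.d (domCount P M (k + 1))).cubes H
            ((tgeometry P.d (domCount P M (k + 1))).cubes X)‖ ≤ Mf := by
    intro H hH
    have h := (differentiableOn_and_norm_locE_of_couplingReading (P := P) (M := M) (k := k) X (O := univ) isOpen_univ (h := fun Z _ => H Z)
      (A := 2 * A) (R₃₈ := R₃₈) (r₁ := r₁) hA2 hr₁ hrate hsmall2 (fun Z _ => differentiableOn_const _)
      (fun Z hZ z _ => (hH Z hZ).trans (by
        have := Real.exp_pos (-(R₃₈ * (domSys P M (k + 1)).dj Z)); nlinarith [hH Z hZ, norm_nonneg (H Z)]))).2 0 (mem_univ _)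
    rw [hMf]
    exact h
  by_cases hq0 : q = 0
  · -- the activities agree on the polymers `Z ⊂ X`
    have heq : locE (tgeometry P.d (domCount P M (k + 1))).ι (tgeometry P.d (domCount P M (k + 1))).cubes H₁
          ((tgeometry P.d (domCount P M (k + 1))).cubes X) =
        locE (tgeometry P.d (domCount P M (k + 1))).ι (tgeometry P.d (domCount P M (k + 1))).cubes H₀
          ((tgeometry P.d (domCount P M (k + 1))).cubes X) :=
      locE_congr _ fun Z hZ => by
        have h := hdev Z hZ
        rw [hq0, zero_mul] at h
        exact eq_of_sub_eq_zero (norm_le_zero_iff.1 h)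
    rw [heq, sub_self, norm_zero, hq0, mul_zero]
  have hqpos : 0 < q := lt_of_le_of_ne hq (Ne.symm hq0)
  by_cases hq1 : 1 ≤ q
  · -- crude: both values are bounded by `Mf`
    calc _ ≤ ‖locE (tgeometry P.d (domCount P M (k + 1))).ι (tgeometry P.d (domCount P M (k + 1))).cubes H₁
              ((tgeometry P.d (domCount P M (k + 1))).cubes X)‖ +
            ‖locE (tgeometry P.d (domCount P M (k + 1))).ι (tgeometry P.d (domCount P M (k + 1))).cubes H₀
              ((tgeometry P.d (domCount P M (k + 1))).cubes X)‖ := norm_sub_le _ _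
      _ ≤ Mf + Mf := add_le_add (hbd H₁ hH₁) (hbd H₀ hH₀)
      _ = 2 * Mf * 1 := by ring
      _ ≤ 2 * Mf * q := mul_le_mul_of_nonneg_left hq1 (by positivity)
  · -- Schwarz on the pencil `w ↦ H₀ + w (H₁ − H₀)` over `ball 0 (1/q)`, `1 < 1/q`
    have hq1' : q < 1 := not_le.1 hq1
    have hR₁ : 1 < 1 / q := by rw [lt_div_iff₀ hqpos]; linarith
    have hpoly : ∀ Z : (domSys P M (k + 1)).Dom, Subtype.val Z ⊆ Subtype.val X → ∀ w ∈ ball (0 : ℂ) (1 / q),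
        ‖H₀ Z + w * (H₁ Z - H₀ Z)‖ ≤ 2 * A * Real.exp (-(R₃₈ * (domSys P M (k + 1)).dj Z)) := by
      intro Z hZ w hw
      rw [mem_ball_zero_iff] at hw
      have he := Real.exp_pos (-(R₃₈ * (domSys P M (k + 1)).dj Z))
      have h1 : ‖w * (H₁ Z - H₀ Z)‖ ≤ 1 / q * (q * (A * Real.exp (-(R₃₈ * (domSys P M (k + 1)).dj Z)))) := by
        rw [norm_mul]
        exact mul_le_mul hw.le (hdev Z hZ) (norm_nonneg _) (by positivity)
      calc ‖H₀ Z + w * (H₁ Z - H₀ Z)‖ ≤ ‖H₀ Z‖ + ‖w * (H₁ Z - H₀ Z)‖ := norm_add_le _ _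
        _ ≤ A * Real.exp (-(R₃₈ * (domSys P M (k + 1)).dj Z)) + 1 / q * (q * (A * Real.exp (-(R₃₈ * (domSys P M (k + 1)).dj Z)))) :=
            add_le_add (hH₀ Z hZ) h1
        _ = 2 * A * Real.exp (-(R₃₈ * (domSys P M (k + 1)).dj Z)) := by field_simp; ring
    have hhol : ∀ Z : (domSys P M (k + 1)).Dom, Subtype.val Z ⊆ Subtype.val X →
        DifferentiableOn ℂ (fun w : ℂ => H₀ Z + w * (H₁ Z - H₀ Z)) (ball 0 (1 / q)) := by
      intro Z _
      fun_prop
    have h := differentiableOn_and_norm_locE_of_couplingReading (P := P) (M := M) (k := k) X (O := ball (0 : ℂ) (1 / q)) isOpen_ball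
      (h := fun Z w => H₀ Z + w * (H₁ Z - H₀ Z)) (A := 2 * A) (R₃₈ := R₃₈) (r₁ := r₁) hA2 hr₁ hrate hsmall2 hhol hpoly
    rw [← hMf] at h
    have hS := norm_sub_le_of_diffOn_ball
      (f := fun w => locE (tgeometry P.d (domCount P M (k + 1))).ι (tgeometry P.d (domCount P M (k + 1))).cubes
        (fun Z => H₀ Z + w * (H₁ Z - H₀ Z)) ((tgeometry P.d (domCount P M (k + 1))).cubes X)) (Mf := Mf) hR₁ h.1 h.2
    have hpen1 : locE (tgeometry P.d (domCount P M (k + 1))).ι (tgeometry P.d (domCount P M (k + 1))).cubes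
          (fun Z => H₀ Z + (1 : ℂ) * (H₁ Z - H₀ Z)) ((tgeometry P.d (domCount P M (k + 1))).cubes X) =
        locE (tgeometry P.d (domCount P M (k + 1))).ι (tgeometry P.d (domCount P M (k + 1))).cubes H₁
          ((tgeometry P.d (domCount P M (k + 1))).cubes X) :=
      locE_congr _ fun Z _ => by ring
    have hpen0 : locE (tgeometry P.d (domCount P M (k + 1))).ι (tgeometry P.d (domCount P M (k + 1))).cubes
          (fun Z => H₀ Z + (0 : ℂ) * (H₁ Z - H₀ Z)) ((tgeometry P.d (domCount P M (k + 1))).cubes X) =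
        locE (tgeometry P.d (domCount P M (k + 1))).ι (tgeometry P.d (domCount P M (k + 1))).cubes H₀
          ((tgeometry P.d (domCount P M (k + 1))).cubes X) :=
      locE_congr _ fun Z _ => by ring
    rw [hpen1, hpen0] at hS
    calc _ ≤ 2 * Mf / (1 / q) := hS
      _ = 2 * Mf * q := by field_simp

end Step

end YMDAG.N10

end
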